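import Summits.QuantumFields.YangMills.Theorems.BalabanUVNodesK2NamedJetsLimit

/-!
# Crux K2⁷ `EndpointGivenBR13SepCoPH` (stmt-QuantumFields-20543), LINE 2 — THE CORNER ROAD's SIGN CUTS (hypothesis form; 0 `def`, 0 `sorry`): the ∃κ sign edition
# AnchorPositiveᴷ ⟺ the ∀κ sign twin {Anchorᴷ, Signᴷ} (two candidate v7 cuts carry the SAME obligations); under LINE 2″ v6's REGISTERED XL text 2ᴮ″ follows BY NAME; the
# PINNED SIGN EDITION LINE 2‴ {U3ᴷ, anchor AT A PIN κ⋆, `0 < lim β⁰(κ⋆ F.L)` per family}; and THE κ-FREE CUT LINE 2⁰ {U3ᴷ, CornerSignᴷ} — K3⁷'s history moduli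
# MANUFACTURE the corner values (McShane), so THE END needs of def-T's β only the asymptotic-freedom SIGN of its corner values: no colour datum, no pin, no `def`

Cell `ym-nodeO-ideate`, PROVER seat `ym-nodeO-port-1` (gen 2; director-ym №206 (3) ∕ R393 (a): port the v₀-free corner road for K2⁷ LINE 2 so that the plan can register a v7
LINE 2 against LANDED decls).  Third file of the corner road after `BalabanUVNodesK2CornerRoad` (p599976, this seat gen 0: N17 + anchor ⟹ `RemAt`∕`RunRemAt`; the
three-stub line and its ∀κ sign twin) and `BalabanUVNodesK2NamedJetsLimit` (p607079, seat `ym-nodeO-d1-w1`: the HYPOTHESIS-FREE limit of `beta0OfJs`, v6's 1ᴬ located, v6's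
pair ⟺ one ∃κ text, LINE 2″ `EndpointGivenBR13SepCoPH_of_u3K_anchorPositiveK` = idea-7 ed.4 §9.1∕9.2a∕9.3∕9.4a–c).  THIS FILE adds only what neither has (no decl restated;
both imported BY NAME): idea-7 §9.2e ∕ 9.4d and the pinned SIGN keying.  Helper for crux K2⁷ = stmt-QuantumFields-20543 (`--supports … --as helper`); count-neutral; NO skeleton
is registered by this file; the v7 cut stays the plan's.
ATTRIBUTION.  idea-7 `Cruxes/EndpointGivenBR13SepCoPH/CornerLimitSignSketch.lean` ed.4 §9 (planner-ym-nodeO-idea-7 g5; 9.2e `d1SignShadowingAnchor13K_iff_positivelyNamable`, 9.4d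
`runRemAtSomeJetsV5_of_u3TripleK_anchorPositiveK`); CRIT-2 ROUND 4 (`CRIT-2-ROUND4-idea7.md`: (3) «the honest third stub of LINE 2 is ∃κ-keyed OR PINNED»; RE-DEAL (b) PIN κ⋆
before θ; KIT REC «certify ONE sign ∕ coefficient at a pinned member»); DEF-1 `K2V6Defs` v1.1 §4 (p606356: the pinned VALUE keying `EndpointGivenBR13SepCoPH_of_pin`, whose
`hRun` text is read here VERBATIM); g1-p3 `Gaps.CapTailPinnedLimitSign` («the SIGN half of the pinned limit carries END grade»).

CONTENTS.  §1 floor ⟺ sign for the named numbers (`lim_pos_of_eventuallyPos`, `eventuallyPos_iff_lim_pos`; converse of p607079's `eventuallyPos_of_lim_pos`).  §2 at v6's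
keying: ★ `signK_iff_limPosAtAnchoringK` (9.2e: p599976's ∀κ letter Signᴷ ⟺ «every anchoring κ has `0 < lim`» — record-side like 1ᴬ), `anchorPositiveK_of_anchorK_signK` and
★★ `anchorPositiveK_iff_anchorK_and_signK` (with p607079's `signK_of_anchorPositiveK`: CRIT-2 ROUND 4's LINE 2″ {`stub_u3Triple13K`, `stub_anchorPositiveJets13K`} and CRIT-2
2e∕2f's sign twin {`stub_u3Triple13K`, `stub_anchorSomeJets13K`, `stub_d1Sign13K`} (concluder p599976 `EndpointGivenBR13SepCoPH_of_u3K_anchorK_signK`) are ONE cut up to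
bracketing), ★ `runRemAtSomeJets_of_u3K_anchorPositiveK` (9.4d: under LINE 2″ v6's REGISTERED `K2V6Defs.RunRemAtSomeJets` follows BY NAME — LINE 2″ asks the SIGN of the
named limit where LINE 1′ asks its VALUE).  §3 THE PINNED SIGN EDITION, pin `κ : ℕ → StepColourData` a PARAMETER (none chosen — the β sub-cell's (P6) word):
`limPosAtPin_of_pinnedDrift` (DEF-1's θ-free pinned (D1) text ⟹ the θ-free pinned SIGN text `∀ F, 0 < CauchyRate.lim (beta0OfJs F (κ F.L))`: the sign stub is the WEAKER
β-row item), `limPosAtPin_iff_eventuallyPosAtPin` (its floor form — the shape a certified tail bound delivers), `anchorAtPin_of_runRemAtPin` (DEF-1's pinned run text ⟹ the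
pinned naming text), `anchorPositiveK_of_anchorAtPin_limPosAtPin`, ★★★ `EndpointGivenBR13SepCoPH_of_u3K_anchorAtPin_limPosAtPin` (LINE 2‴ = {U3ᴷ, AnchorAtPinᴷ κ⋆,
LimPosAtPin κ⋆} ⟹ the crux decl BY NAME through p607079's LINE 2″ concluder), ★★ `EndpointGivenBR13SepCoPH_of_u3K_runRemAtPin_limPosAtPin` (DEF-1's pinned run text + the
pinned SIGN + U3ᴷ ⟹ the crux decl: compared with `K2V6Defs.EndpointGivenBR13SepCoPH_of_pin`, K3⁷'s letters buy the β row down from `lim = stepBal 2 F.L` to `0 < lim`),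
`runRemAtSomeJets_of_u3K_anchorAtPin` (pinned naming + U3ᴷ ⟹ v6's 2ᴮ″ BY NAME, the pin is the witness).  §4 THE κ-FREE CUT (plan g83 (q-K2-3) «no costume», answered
from the corner road WITHOUT a new object): ★★ `exists_scaleAnchor_of_histLipschitz` (`HistLipschitz Λ γ β`, `0 < γ` ⟹ `∃ b, ScaleAnchor β b` — K3⁷'s second letter
MANUFACTURES the corner values, by McShane extension of the per-scale Lipschitz `β_k` to the zero history; with DEF-1's `ScaleAnchor.eq` they are DETERMINED by β), ★★★
`EndpointGivenBR13SepCoPH_of_u3K_cornerSignK` (LINE 2⁰ = {U3ᴷ, CornerSignᴷ «every anchoring sequence of a prefixed admissible record's β is eventually ≥ some e > 0»} ⟹ the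
crux decl BY NAME through p599976's sign road at scale 1 — TWO stubs, the private one ONE BIT about def-T's β; no κ, no pin, no `OneLoopSplit`∕`bOwn`, no drift VALUE),
★★ `EndpointGivenBR13SepCoPH_of_u3K_cornerLimPosK` (limit form = idea-7 ed.1's private bit ∕ p607079's corner-sign conjunct without its ∃κ guard), `EndpointGivenBR13SepCoPH_of_u3K_someCornerPosK`
(∃-form twin = the κ-free AnchorPositiveᴷ), `cornerSignK_of_anchorPositiveK` ∕
`anchorPositiveK_of_anchorK_cornerSignK` (AnchorPositiveᴷ ⟺ Anchorᴷ ∧ CornerSignᴷ: LINE 2″'s private stub = the κ-free sign bit + the bare identification, so LINE 2″ and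
LINE 2‴ both factor through LINE 2⁰).

HONEST FRAMING.  Implications between displayed HYPOTHESIS SHAPES plus the tree's hypothesis-free convergence of a typed real sequence; NOTHING of Bałaban's analysis is
asserted or discharged: N17, the history moduli, the identification (at a free κ or at a pin), the VALUE and the SIGN of the named limit are hypotheses inhabited at no θ and
certified at no pin here (instance 0∕1; 0 coefficients ∕ signs computed; no pin chosen); K2⁷ ∕ K3⁷ ∕ NODE O NOT proved (skeleton of record v6 5a75a2378c79b303: 2 registered
stubs, 0 closed; LINE 2 unregistered); counts unmoved (typed 28∕28 · discharged 5∕27); [Balaban1987RG1] Thm 2 + (0.31) p. 259 is UNPROVED IN PRINT; route R4 closes the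
CONDITIONAL finite-𝕋⁴ rung `BalabanLadder.UV` only — NOT the continuum limit, NOT ℝ⁴, NOT OS, NOT the Yang–Mills mass gap, NOT Clay.  No `def`, no `instance`, no `notation`,
no `axiom`.  Sources (context only; nothing printed is used as a hypothesis): [I] = [Balaban1987RG1] CMP **109** (1987): Thm 2 p. 259 (first sentence), (1.3) p. 260,
(1.20)–(1.22) p. 264, Thm 3 p. 264, (2.12)–(2.14) p. 268, (5.10) p. 293.
-/

noncomputable section

namespace Summit.QuantumFields.YangMills.Theorems.BalabanUVNodesK2CornerRoadSign

open Filter Topology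
open Literature.MathematicalPhysics.QuantumFieldTheory.Balaban1983to89
open Literature.MathematicalPhysics.QuantumFieldTheory.Balaban1983to89.FlowStep
open Literature.MathematicalPhysics.QuantumFieldTheory.Balaban1983to89.T4Continuum (T4Family)
open Literature.MathematicalPhysics.QuantumFieldTheory.Balaban1983to89.T4CouplingMatching (ScaleShiftRate HistLipschitz)
open Literature.MathematicalPhysics.QuantumFieldTheory.Balaban1983to89.Beta.Drift (OneLoopDrift)
open Literature.MathematicalPhysics.QuantumFieldTheory.Balaban1983to89.Beta.RateCertificate (CauchyRate)
open Summit.QuantumFields.YangMills.Theorems.BalabanUVNodesK2JsOfRecord (StepColourData beta0OfJs stepBal_L_pos)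
open Summit.QuantumFields.YangMills.Theorems.BalabanUVNodesK2NamedJetsRemAt (ScaleAnchor)
open Summit.QuantumFields.YangMills.Theorems.BalabanUVNodesK2NamedJetsRunRemAt (RunRemAt)
open Summit.QuantumFields.YangMills.Theorems.BalabanUVNodesK2V6Defs (Window13 RunRemAtSomeJets)
open Summit.QuantumFields.YangMills.Theorems.BalabanUVNodesK2CornerRoad (runRemAtSomeJetsK_of_u3K_anchorK tendsto_of_scaleShiftRate_scaleAnchor
  endpointExistence_of_letters_scaleAnchor_eventuallyPos)
open Summit.QuantumFields.YangMills.Theorems.BalabanUVNodesK2NamedJetsLimit (tendsto_beta0OfJs drift_iff_lim_eq eventuallyFloor_of_lim_pos eventuallyPos_of_lim_pos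
  signK_of_anchorPositiveK EndpointGivenBR13SepCoPH_of_u3K_anchorPositiveK)

/-! ## §1 Floor ⟺ sign for the named one-loop numbers (the tree's hypothesis-free convergence, p607079 `tendsto_beta0OfJs`) -/

section Floor

variable (F : T4Family) (κ : StepColourData)

/-- An eventual positive floor on the named numbers gives a POSITIVE named limit (`ge_of_tendsto` on p607079's hypothesis-free `tendsto_beta0OfJs`) — converse of
p607079's `eventuallyPos_of_lim_pos`. [folklore] -/
theorem lim_pos_of_eventuallyPos {e : ℝ} (he : 0 < e) (hev : ∃ k₀ : ℕ, ∀ k, k₀ ≤ k → e ≤ beta0OfJs F κ k) : 0 < CauchyRate.lim (beta0OfJs F κ) := by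
  obtain ⟨k₀, hk₀⟩ := hev
  exact lt_of_lt_of_le he (ge_of_tendsto (tendsto_beta0OfJs F κ) (Filter.eventually_atTop.mpr ⟨k₀, hk₀⟩))

/-- **FLOOR ⟺ SIGN**: `(∃ e > 0, ∃ k₀, ∀ k ≥ k₀, e ≤ beta0OfJs F κ k) ⟺ 0 < CauchyRate.lim (beta0OfJs F κ)` — p599976's eventual-sign currency and idea-7's limit-sign
currency are ONE statement per `(F, κ)`. [folklore] -/
theorem eventuallyPos_iff_lim_pos : (∃ e : ℝ, 0 < e ∧ ∃ k₀ : ℕ, ∀ k, k₀ ≤ k → e ≤ beta0OfJs F κ k) ↔ 0 < CauchyRate.lim (beta0OfJs F κ) :=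
  ⟨fun ⟨_, he, hev⟩ => lim_pos_of_eventuallyPos F κ he hev, eventuallyPos_of_lim_pos F κ⟩

end Floor

/-! ## §2 At v6's keying: the ∀κ sign letter located; the ∃κ sign edition ⟺ the sign twin's pair; under LINE 2″ v6's registered 2ᴮ″ BY NAME.
Texts INLINE (prefix `(unity ∧ slots) → Admissible → (B) → Window13 F θ hP`, `K2V6Defs.window13_iff` = `Iff.rfl` against p599976's ∕ p607079's unfolded window):
Anchorᴷ `… → ∃ κ, ScaleAnchor D.βfun (fun k => θ.cβ * beta0OfJs F κ k)` (p599976 `hA`); Signᴷ `∀ F κ θ hP, … → ScaleAnchor … → ∃ e > 0, ∃ k₀, ∀ k ≥ k₀, e ≤ beta0OfJs F κ k`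
(p599976 `hs`); AnchorPositiveᴷ `… → ∃ κ, 0 < CauchyRate.lim (beta0OfJs F κ) ∧ ScaleAnchor …` (p607079 `hA`; idea-7 :1890 with `limOfJs`∕`Names` spelled out); U3ᴷ (K3⁷-shared)
`… → ∃ c C ρ Λ, 0 ≤ c ∧ 0 < ρ ∧ ρ < 1 ∧ ScaleShiftRate c ρ θ.γ D.βfun ∧ HistLipschitz Λ θ.γ D.βfun ∧ FadingMemory C ρ Λ`. -/

section SignCuts

/-- **★ (idea-7 9.2e) p599976's ∀κ SIGN LETTER Signᴷ LOCATED: Signᴷ ⟺ «every colour datum ANCHORING a prefixed admissible record has POSITIVE named limit»** (§1 floor ⟺ sign,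
pointwise) — the same anchor-guarded ∀κ shape as v6's 1ᴬ (p607079 `d1AtAnchoredJets_iff_anchoredOnVariety`, VALUE `= stepBal 2 F.L` replaced by SIGN `> 0`), hence a statement
about WHICH colour data anchor def-T's records — record-side as dealt (CRIT-2 ROUND 4 (3): idea-7's self-correction ACCEPTED). [cite: Balaban1987RG1, (1.3) p.260 and (2.13) p.268] -/
theorem signK_iff_limPosAtAnchoringK :
    (∀ (F : T4Family) (κ : StepColourData) (θ : Node00.Stage13HParams F 2) (hP : θ.Provisos₁₃SepCoPH F 2), (θ.ZhUnity F 2 ∧ θ.SlotsNondegenerate₁₃ F 2) → θ.Admissible F 2 →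
        B16.EndStatementBPrinted (Node00.datumOfRecord₁₃SepCoPH F 2 θ hP).C → Window13 F θ hP →
        ScaleAnchor (Node00.datumOfRecord₁₃SepCoPH F 2 θ hP).βfun (fun k => θ.cβ * beta0OfJs F κ k) →
        ∃ e : ℝ, 0 < e ∧ ∃ k₀ : ℕ, ∀ k, k₀ ≤ k → e ≤ beta0OfJs F κ k) ↔
      ∀ (F : T4Family) (κ : StepColourData) (θ : Node00.Stage13HParams F 2) (hP : θ.Provisos₁₃SepCoPH F 2), (θ.ZhUnity F 2 ∧ θ.SlotsNondegenerate₁₃ F 2) → θ.Admissible F 2 →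
        B16.EndStatementBPrinted (Node00.datumOfRecord₁₃SepCoPH F 2 θ hP).C → Window13 F θ hP →
        ScaleAnchor (Node00.datumOfRecord₁₃SepCoPH F 2 θ hP).βfun (fun k => θ.cβ * beta0OfJs F κ k) →
        0 < CauchyRate.lim (beta0OfJs F κ) :=
  ⟨fun h F κ θ hP hU hθ hB hwin hN => (eventuallyPos_iff_lim_pos F κ).mp (h F κ θ hP hU hθ hB hwin hN),
    fun h F κ θ hP hU hθ hB hwin hN => (eventuallyPos_iff_lim_pos F κ).mpr (h F κ θ hP hU hθ hB hwin hN)⟩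

/-- **Anchorᴷ + Signᴷ ⟹ AnchorPositiveᴷ**: the anchoring κ of Anchorᴷ has eventually positive numbers by Signᴷ, hence a positive limit (§1).  (p599976's sign twin's private pair
feeds LINE 2″'s single private stub.) [cite: Balaban1987RG1, (1.3) p.260] -/
theorem anchorPositiveK_of_anchorK_signK
    (hA : ∀ (F : T4Family) (θ : Node00.Stage13HParams F 2) (hP : θ.Provisos₁₃SepCoPH F 2), (θ.ZhUnity F 2 ∧ θ.SlotsNondegenerate₁₃ F 2) → θ.Admissible F 2 →
      B16.EndStatementBPrinted (Node00.datumOfRecord₁₃SepCoPH F 2 θ hP).C → Window13 F θ hP →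
      ∃ κ : StepColourData, ScaleAnchor (Node00.datumOfRecord₁₃SepCoPH F 2 θ hP).βfun (fun k => θ.cβ * beta0OfJs F κ k))
    (hs : ∀ (F : T4Family) (κ : StepColourData) (θ : Node00.Stage13HParams F 2) (hP : θ.Provisos₁₃SepCoPH F 2), (θ.ZhUnity F 2 ∧ θ.SlotsNondegenerate₁₃ F 2) → θ.Admissible F 2 →
      B16.EndStatementBPrinted (Node00.datumOfRecord₁₃SepCoPH F 2 θ hP).C → Window13 F θ hP →
      ScaleAnchor (Node00.datumOfRecord₁₃SepCoPH F 2 θ hP).βfun (fun k => θ.cβ * beta0OfJs F κ k) →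
      ∃ e : ℝ, 0 < e ∧ ∃ k₀ : ℕ, ∀ k, k₀ ≤ k → e ≤ beta0OfJs F κ k) :
    ∀ (F : T4Family) (θ : Node00.Stage13HParams F 2) (hP : θ.Provisos₁₃SepCoPH F 2), (θ.ZhUnity F 2 ∧ θ.SlotsNondegenerate₁₃ F 2) → θ.Admissible F 2 →
      B16.EndStatementBPrinted (Node00.datumOfRecord₁₃SepCoPH F 2 θ hP).C → Window13 F θ hP →
      ∃ κ : StepColourData, 0 < CauchyRate.lim (beta0OfJs F κ) ∧ ScaleAnchor (Node00.datumOfRecord₁₃SepCoPH F 2 θ hP).βfun (fun k => θ.cβ * beta0OfJs F κ k) :=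
  fun F θ hP hU hθ hB hwin => by
  obtain ⟨κ, hN⟩ := hA F θ hP hU hθ hB hwin
  obtain ⟨e, he, hev⟩ := hs F κ θ hP hU hθ hB hwin hN
  exact ⟨κ, lim_pos_of_eventuallyPos F κ he hev, hN⟩

/-- **★★ THE TWO SIGN CUTS ARE ONE: AnchorPositiveᴷ ⟺ Anchorᴷ ∧ Signᴷ** (← `anchorPositiveK_of_anchorK_signK`; → projection and p607079's `signK_of_anchorPositiveK`: every other
anchoring κ′ shares the positive κ's numbers).  So CRIT-2 ROUND 4's LINE 2″ {`stub_u3Triple13K`, `stub_anchorPositiveJets13K`} (concluder p607079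
`EndpointGivenBR13SepCoPH_of_u3K_anchorPositiveK`) and CRIT-2 2e∕2f's sign twin {`stub_u3Triple13K`, `stub_anchorSomeJets13K`, `stub_d1Sign13K`} (concluder p599976
`EndpointGivenBR13SepCoPH_of_u3K_anchorK_signK`) carry the SAME obligations; the v7 choice between them is bracketing, not content. [cite: Balaban1987RG1, (1.3) p.260 and (2.13) p.268] -/
theorem anchorPositiveK_iff_anchorK_and_signK :
    (∀ (F : T4Family) (θ : Node00.Stage13HParams F 2) (hP : θ.Provisos₁₃SepCoPH F 2), (θ.ZhUnity F 2 ∧ θ.SlotsNondegenerate₁₃ F 2) → θ.Admissible F 2 →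
        B16.EndStatementBPrinted (Node00.datumOfRecord₁₃SepCoPH F 2 θ hP).C → Window13 F θ hP →
        ∃ κ : StepColourData, 0 < CauchyRate.lim (beta0OfJs F κ) ∧ ScaleAnchor (Node00.datumOfRecord₁₃SepCoPH F 2 θ hP).βfun (fun k => θ.cβ * beta0OfJs F κ k)) ↔
      ((∀ (F : T4Family) (θ : Node00.Stage13HParams F 2) (hP : θ.Provisos₁₃SepCoPH F 2), (θ.ZhUnity F 2 ∧ θ.SlotsNondegenerate₁₃ F 2) → θ.Admissible F 2 →
          B16.EndStatementBPrinted (Node00.datumOfRecord₁₃SepCoPH F 2 θ hP).C → Window13 F θ hP →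
          ∃ κ : StepColourData, ScaleAnchor (Node00.datumOfRecord₁₃SepCoPH F 2 θ hP).βfun (fun k => θ.cβ * beta0OfJs F κ k)) ∧
        ∀ (F : T4Family) (κ : StepColourData) (θ : Node00.Stage13HParams F 2) (hP : θ.Provisos₁₃SepCoPH F 2), (θ.ZhUnity F 2 ∧ θ.SlotsNondegenerate₁₃ F 2) → θ.Admissible F 2 →
          B16.EndStatementBPrinted (Node00.datumOfRecord₁₃SepCoPH F 2 θ hP).C → Window13 F θ hP →
          ScaleAnchor (Node00.datumOfRecord₁₃SepCoPH F 2 θ hP).βfun (fun k => θ.cβ * beta0OfJs F κ k) →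
          ∃ e : ℝ, 0 < e ∧ ∃ k₀ : ℕ, ∀ k, k₀ ≤ k → e ≤ beta0OfJs F κ k) := by
  refine ⟨fun h => ⟨fun F θ hP hU hθ hB hwin => ?_, signK_of_anchorPositiveK h⟩, fun ⟨hA, hs⟩ => anchorPositiveK_of_anchorK_signK hA hs⟩
  obtain ⟨κ, -, hN⟩ := h F θ hP hU hθ hB hwin
  exact ⟨κ, hN⟩

/-- **★ (idea-7 9.4d) UNDER LINE 2″, v6's REGISTERED XL TEXT 2ᴮ″ `K2V6Defs.RunRemAtSomeJets` FOLLOWS BY NAME: U3ᴷ → AnchorPositiveᴷ → 2ᴮ″** (its anchor conjunct into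
p599976's locating implication `runRemAtSomeJetsK_of_u3K_anchorK`; `K2V6Defs.runRemAtSomeJets_iff_inline` is `Iff.rfl`) — on K3⁷'s letters LINE 2″ asks the SIGN of the named
limit where LINE 1′ asks its VALUE, and v6's 2ᴮ″ is paid either way. [cite: Balaban1987RG1, Thm 3 p.264, (1.20)-(1.22) p.264 and (2.13) p.268] -/
theorem runRemAtSomeJets_of_u3K_anchorPositiveK
    (hU3 : ∀ (F : T4Family) (θ : Node00.Stage13HParams F 2) (hP : θ.Provisos₁₃SepCoPH F 2), (θ.ZhUnity F 2 ∧ θ.SlotsNondegenerate₁₃ F 2) → θ.Admissible F 2 →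
      B16.EndStatementBPrinted (Node00.datumOfRecord₁₃SepCoPH F 2 θ hP).C → Window13 F θ hP →
      ∃ (c C ρ : ℝ) (Λ : ℕ → ℕ → ℝ), 0 ≤ c ∧ 0 < ρ ∧ ρ < 1 ∧ ScaleShiftRate c ρ θ.γ (Node00.datumOfRecord₁₃SepCoPH F 2 θ hP).βfun ∧
        HistLipschitz Λ θ.γ (Node00.datumOfRecord₁₃SepCoPH F 2 θ hP).βfun ∧ T4CouplingMatching.FadingMemory C ρ Λ)
    (hA : ∀ (F : T4Family) (θ : Node00.Stage13HParams F 2) (hP : θ.Provisos₁₃SepCoPH F 2), (θ.ZhUnity F 2 ∧ θ.SlotsNondegenerate₁₃ F 2) → θ.Admissible F 2 →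
      B16.EndStatementBPrinted (Node00.datumOfRecord₁₃SepCoPH F 2 θ hP).C → Window13 F θ hP →
      ∃ κ : StepColourData, 0 < CauchyRate.lim (beta0OfJs F κ) ∧ ScaleAnchor (Node00.datumOfRecord₁₃SepCoPH F 2 θ hP).βfun (fun k => θ.cβ * beta0OfJs F κ k)) :
    RunRemAtSomeJets :=
  runRemAtSomeJetsK_of_u3K_anchorK hU3 fun F θ hP hU hθ hB hwin => by
    obtain ⟨κ, -, hN⟩ := hA F θ hP hU hθ hB hwin
    exact ⟨κ, hN⟩

end SignCuts

/-! ## §3 THE PINNED SIGN EDITION (LINE 2‴), pin `κ : ℕ → StepColourData` a PARAMETER chosen BEFORE θ (CRIT-2 ROUND 4 RE-DEAL (b) in SIGN currency): texts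
AnchorAtPinᴷ κ `∀ F θ hP, prefix → ScaleAnchor D.βfun (fun k => θ.cβ * beta0OfJs F (κ F.L) k)` (def-T: the record is NAMED by the pinned member; XL), LimPosAtPin κ
`∀ F, 0 < CauchyRate.lim (beta0OfJs F (κ F.L))` (θ-FREE: ONE SIGN PER FAMILY — g1-p3's «SIGN half»; the shape a certified computation at the pin delivers), and DEF-1
`K2V6Defs` §4's pinned run text `hRun` VERBATIM.  Nothing here says which κ is print's ((P6) undecided). -/

section PinnedSign

variable (κ : ℕ → StepColourData)

/-- **VALUE ⟹ SIGN AT THE PIN: DEF-1's θ-free pinned (D1) text (`K2V6Defs.d1AtAnchoredJets_of_pin`'s ∕ `EndpointGivenBR13SepCoPH_of_pin`'s `hD1`) ⟹ LimPosAtPin** (p607079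
`drift_iff_lim_eq` + `0 < stepBal 2 F.L`) — the pinned SIGN stub is the WEAKER β-row item. [cite: Balaban1987RG1, (1.3) p.260 and (2.13) p.268] -/
theorem limPosAtPin_of_pinnedDrift (hD1 : ∀ F : T4Family, ∃ A : ℝ, OneLoopDrift (B12Normalization.stepBal 2 F.L) A (beta0OfJs F (κ F.L))) :
    ∀ F : T4Family, 0 < CauchyRate.lim (beta0OfJs F (κ F.L)) := fun F => by
  rw [(drift_iff_lim_eq F (κ F.L) 2).mp (hD1 F)]
  exact stepBal_L_pos F two_pos

/-- **LimPosAtPin ⟺ its FLOOR FORM** `∀ F, ∃ e > 0, ∃ k₀, ∀ k ≥ k₀, e ≤ beta0OfJs F (κ F.L) k` (§1, per family) — the θ-free, history-free, coupling-free statement about ONE typed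
real sequence per `L` that a certified tail bound at the pin would deliver (CRIT-2 ROUND 4 KIT REC; nothing certified here). [folklore] -/
theorem limPosAtPin_iff_eventuallyPosAtPin :
    (∀ F : T4Family, 0 < CauchyRate.lim (beta0OfJs F (κ F.L))) ↔ ∀ F : T4Family, ∃ e : ℝ, 0 < e ∧ ∃ k₀ : ℕ, ∀ k, k₀ ≤ k → e ≤ beta0OfJs F (κ F.L) k :=
  forall_congr' fun F => (eventuallyPos_iff_lim_pos F (κ F.L)).symm

/-- DEF-1's pinned RUN text (`K2V6Defs` §4 `hRun`, VERBATIM) ⟹ AnchorAtPinᴷ: the run letter at the pin carries the per-scale anchor at the pin as a conjunct. [folklore] -/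
theorem anchorAtPin_of_runRemAtPin
    (hRun : ∀ (F : T4Family) (θ : Node00.Stage13HParams F 2) (hP : θ.Provisos₁₃SepCoPH F 2), (θ.ZhUnity F 2 ∧ θ.SlotsNondegenerate₁₃ F 2) → θ.Admissible F 2 →
      B16.EndStatementBPrinted (Node00.datumOfRecord₁₃SepCoPH F 2 θ hP).C → Window13 F θ hP → RunRemAt F (κ F.L) θ hP θ.cβ) :
    ∀ (F : T4Family) (θ : Node00.Stage13HParams F 2) (hP : θ.Provisos₁₃SepCoPH F 2), (θ.ZhUnity F 2 ∧ θ.SlotsNondegenerate₁₃ F 2) → θ.Admissible F 2 →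
      B16.EndStatementBPrinted (Node00.datumOfRecord₁₃SepCoPH F 2 θ hP).C → Window13 F θ hP →
      ScaleAnchor (Node00.datumOfRecord₁₃SepCoPH F 2 θ hP).βfun (fun k => θ.cβ * beta0OfJs F (κ F.L) k) := fun F θ hP hU hθ hB hwin => by
  obtain ⟨-, -, -, -, -, -, hanch, -⟩ := hRun F θ hP hU hθ hB hwin
  exact hanch

/-- **AnchorAtPinᴷ κ + LimPosAtPin κ ⟹ AnchorPositiveᴷ** (the pinned member is the ∃κ witness at every prefixed tuple). [folklore] -/
theorem anchorPositiveK_of_anchorAtPin_limPosAtPin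
    (hN : ∀ (F : T4Family) (θ : Node00.Stage13HParams F 2) (hP : θ.Provisos₁₃SepCoPH F 2), (θ.ZhUnity F 2 ∧ θ.SlotsNondegenerate₁₃ F 2) → θ.Admissible F 2 →
      B16.EndStatementBPrinted (Node00.datumOfRecord₁₃SepCoPH F 2 θ hP).C → Window13 F θ hP →
      ScaleAnchor (Node00.datumOfRecord₁₃SepCoPH F 2 θ hP).βfun (fun k => θ.cβ * beta0OfJs F (κ F.L) k))
    (hpos : ∀ F : T4Family, 0 < CauchyRate.lim (beta0OfJs F (κ F.L))) :
    ∀ (F : T4Family) (θ : Node00.Stage13HParams F 2) (hP : θ.Provisos₁₃SepCoPH F 2), (θ.ZhUnity F 2 ∧ θ.SlotsNondegenerate₁₃ F 2) → θ.Admissible F 2 →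
      B16.EndStatementBPrinted (Node00.datumOfRecord₁₃SepCoPH F 2 θ hP).C → Window13 F θ hP →
      ∃ κ : StepColourData, 0 < CauchyRate.lim (beta0OfJs F κ) ∧ ScaleAnchor (Node00.datumOfRecord₁₃SepCoPH F 2 θ hP).βfun (fun k => θ.cβ * beta0OfJs F κ k) :=
  fun F θ hP hU hθ hB hwin => ⟨κ F.L, hpos F, hN F θ hP hU hθ hB hwin⟩

/-- **★★★ LINE 2‴ — THE PINNED SIGN EDITION — concluding THE CRUX DECL BY NAME: U3ᴷ + AnchorAtPinᴷ κ⋆ + LimPosAtPin κ⋆ ⟹ `EndpointGivenBR13SepCoPH`** (through p607079's LINE 2″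
concluder `EndpointGivenBR13SepCoPH_of_u3K_anchorPositiveK`, itself p599976's sign road with the floor `lim ∕ 2` from the tree).  The three stubs sit with three owners: K3⁷'s
letters (shared), def-T's identification AT A NAMED MEMBER (XL, NODE O's wall), and ONE SIGN PER FAMILY at the pin (θ-free β-row item, certifiable member by member).  A pinned
v7 `{stub_u3Triple13K, stub_anchorAtPin13K, stub_limPosAtPin13}` with a skeleton-level `def κ⋆` closes sorry-free by
`EndpointGivenBR13SepCoPH_of_u3K_anchorAtPin_limPosAtPin κ⋆ stub_u3Triple13K stub_anchorAtPin13K stub_limPosAtPin13`.  CONDITIONAL on three hypothesis shapes; no pin chosen;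
K2⁷ NOT closed; nothing of Bałaban asserted. [cite: Balaban1987RG1, Thm 2 p.259 (first sentence), (1.3) p.260, (1.20)-(1.22) p.264 and (2.13) p.268] -/
theorem EndpointGivenBR13SepCoPH_of_u3K_anchorAtPin_limPosAtPin
    (hU3 : ∀ (F : T4Family) (θ : Node00.Stage13HParams F 2) (hP : θ.Provisos₁₃SepCoPH F 2), (θ.ZhUnity F 2 ∧ θ.SlotsNondegenerate₁₃ F 2) → θ.Admissible F 2 →
      B16.EndStatementBPrinted (Node00.datumOfRecord₁₃SepCoPH F 2 θ hP).C → Window13 F θ hP →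
      ∃ (c C ρ : ℝ) (Λ : ℕ → ℕ → ℝ), 0 ≤ c ∧ 0 < ρ ∧ ρ < 1 ∧ ScaleShiftRate c ρ θ.γ (Node00.datumOfRecord₁₃SepCoPH F 2 θ hP).βfun ∧
        HistLipschitz Λ θ.γ (Node00.datumOfRecord₁₃SepCoPH F 2 θ hP).βfun ∧ T4CouplingMatching.FadingMemory C ρ Λ)
    (hN : ∀ (F : T4Family) (θ : Node00.Stage13HParams F 2) (hP : θ.Provisos₁₃SepCoPH F 2), (θ.ZhUnity F 2 ∧ θ.SlotsNondegenerate₁₃ F 2) → θ.Admissible F 2 →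
      B16.EndStatementBPrinted (Node00.datumOfRecord₁₃SepCoPH F 2 θ hP).C → Window13 F θ hP →
      ScaleAnchor (Node00.datumOfRecord₁₃SepCoPH F 2 θ hP).βfun (fun k => θ.cβ * beta0OfJs F (κ F.L) k))
    (hpos : ∀ F : T4Family, 0 < CauchyRate.lim (beta0OfJs F (κ F.L))) :
    Summit.QuantumFields.YangMills.Theses.BalabanUVNodes.EndpointGivenBR13SepCoPH :=
  EndpointGivenBR13SepCoPH_of_u3K_anchorPositiveK hU3 (anchorPositiveK_of_anchorAtPin_limPosAtPin κ hN hpos)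

/-- **★★ DEF-1's PINNED RUN TEXT + THE PINNED SIGN + U3ᴷ ⟹ THE CRUX DECL BY NAME** — compare `K2V6Defs.EndpointGivenBR13SepCoPH_of_pin κ hD1 hRun` (pinned VALUE + pinned run
text, no U3): on K3⁷'s letters the β row's pinned obligation drops from the VALUE `lim = stepBal 2 F.L` (`hD1`, via `limPosAtPin_of_pinnedDrift`) to the SIGN `0 < lim`.
CONDITIONAL; no pin chosen; K2⁷ NOT closed. [cite: Balaban1987RG1, Thm 2 p.259 (first sentence), Thm 3 p.264 and (2.13) p.268] -/
theorem EndpointGivenBR13SepCoPH_of_u3K_runRemAtPin_limPosAtPin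
    (hU3 : ∀ (F : T4Family) (θ : Node00.Stage13HParams F 2) (hP : θ.Provisos₁₃SepCoPH F 2), (θ.ZhUnity F 2 ∧ θ.SlotsNondegenerate₁₃ F 2) → θ.Admissible F 2 →
      B16.EndStatementBPrinted (Node00.datumOfRecord₁₃SepCoPH F 2 θ hP).C → Window13 F θ hP →
      ∃ (c C ρ : ℝ) (Λ : ℕ → ℕ → ℝ), 0 ≤ c ∧ 0 < ρ ∧ ρ < 1 ∧ ScaleShiftRate c ρ θ.γ (Node00.datumOfRecord₁₃SepCoPH F 2 θ hP).βfun ∧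
        HistLipschitz Λ θ.γ (Node00.datumOfRecord₁₃SepCoPH F 2 θ hP).βfun ∧ T4CouplingMatching.FadingMemory C ρ Λ)
    (hRun : ∀ (F : T4Family) (θ : Node00.Stage13HParams F 2) (hP : θ.Provisos₁₃SepCoPH F 2), (θ.ZhUnity F 2 ∧ θ.SlotsNondegenerate₁₃ F 2) → θ.Admissible F 2 →
      B16.EndStatementBPrinted (Node00.datumOfRecord₁₃SepCoPH F 2 θ hP).C → Window13 F θ hP → RunRemAt F (κ F.L) θ hP θ.cβ)
    (hpos : ∀ F : T4Family, 0 < CauchyRate.lim (beta0OfJs F (κ F.L))) :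
    Summit.QuantumFields.YangMills.Theses.BalabanUVNodes.EndpointGivenBR13SepCoPH :=
  EndpointGivenBR13SepCoPH_of_u3K_anchorAtPin_limPosAtPin κ hU3 (anchorAtPin_of_runRemAtPin κ hRun) hpos

/-- **AnchorAtPinᴷ κ + U3ᴷ ⟹ v6's REGISTERED 2ᴮ″ `K2V6Defs.RunRemAtSomeJets` BY NAME** (p599976's locating implication; the pin is the witness) — so under LINE 2‴ both of v6's
XL letters at the pin are manufactured from K3⁷'s letters + the pinned naming alone; the sign stub is used only by THE END. [cite: Balaban1987RG1, Thm 3 p.264 and (2.13) p.268] -/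
theorem runRemAtSomeJets_of_u3K_anchorAtPin
    (hU3 : ∀ (F : T4Family) (θ : Node00.Stage13HParams F 2) (hP : θ.Provisos₁₃SepCoPH F 2), (θ.ZhUnity F 2 ∧ θ.SlotsNondegenerate₁₃ F 2) → θ.Admissible F 2 →
      B16.EndStatementBPrinted (Node00.datumOfRecord₁₃SepCoPH F 2 θ hP).C → Window13 F θ hP →
      ∃ (c C ρ : ℝ) (Λ : ℕ → ℕ → ℝ), 0 ≤ c ∧ 0 < ρ ∧ ρ < 1 ∧ ScaleShiftRate c ρ θ.γ (Node00.datumOfRecord₁₃SepCoPH F 2 θ hP).βfun ∧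
        HistLipschitz Λ θ.γ (Node00.datumOfRecord₁₃SepCoPH F 2 θ hP).βfun ∧ T4CouplingMatching.FadingMemory C ρ Λ)
    (hN : ∀ (F : T4Family) (θ : Node00.Stage13HParams F 2) (hP : θ.Provisos₁₃SepCoPH F 2), (θ.ZhUnity F 2 ∧ θ.SlotsNondegenerate₁₃ F 2) → θ.Admissible F 2 →
      B16.EndStatementBPrinted (Node00.datumOfRecord₁₃SepCoPH F 2 θ hP).C → Window13 F θ hP →
      ScaleAnchor (Node00.datumOfRecord₁₃SepCoPH F 2 θ hP).βfun (fun k => θ.cβ * beta0OfJs F (κ F.L) k)) :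
    RunRemAtSomeJets :=
  runRemAtSomeJetsK_of_u3K_anchorK hU3 fun F θ hP hU hθ hB hwin => ⟨κ F.L, hN F θ hP hU hθ hB hwin⟩

end PinnedSign

/-! ## §4 THE κ-FREE CUT ON K3⁷'s LETTERS (plan g83 (q-K2-3), «no costume»): the history moduli MANUFACTURE the corner values, so on the corner road THE END needs of def-T's β only
ONE BIT — the asymptotic-freedom SIGN of its corner values.  LINE 2⁰ := {U3ᴷ, CornerSignᴷ}; no colour datum κ, no pin, no `OneLoopSplit`∕`bOwn` object, no `def`.
Texts: CornerSignᴷ (floor form) `∀ F θ hP, prefix → ∀ b : ℕ → ℝ, ScaleAnchor D.βfun b → ∃ e > 0, ∃ k₀, ∀ k ≥ k₀, e ≤ b k`; CornerLimPosᴷ (limit form = idea-7 ed.1's one private bit,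
p607079's `…_and_cornerSign` conjunct without its ∃κ guard) `… → ∀ b, ScaleAnchor D.βfun b → ∀ binf, Tendsto b atTop (𝓝 binf) → 0 < binf`. -/

section KappaFree

/-- **★★ THE HISTORY MODULI MANUFACTURE THE CORNER VALUES: `HistLipschitz Λ γ β` (`0 < γ`) ⟹ `∃ b, ScaleAnchor β b`** — at each scale `β_k` is Lipschitz on `]0,γ]^{k+1}` for the sup
metric (constant `Σ_i |Λ k i|`), so it extends to a Lipschitz function on all histories (McShane, Mathlib's `LipschitzOnWith.extend_real`); its value at the ZERO history is the
corner value `b_k`, and `|β_k(p) − b_k| ≤ (Σ_i |Λ k i|)·max_i p_i` is the per-scale anchor.  With DEF-1's `ScaleAnchor.eq` the corner values are thus DETERMINED BY β and EXIST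
under K3⁷'s second letter alone — no colour datum names them.  Elementary; nothing of Bałaban asserted. [cite: Balaban1987RG1, (2.13) p.268] -/
theorem exists_scaleAnchor_of_histLipschitz {Λ : ℕ → ℕ → ℝ} {γ : ℝ} {β : HBeta} (hγ : 0 < γ) (hL : HistLipschitz Λ γ β) : ∃ b : ℕ → ℝ, ScaleAnchor β b := by
  have hS0 : ∀ k : ℕ, 0 ≤ ∑ i : Fin (k + 1), |Λ k i| := fun k => Finset.sum_nonneg fun i _ => abs_nonneg _
  have hLip : ∀ k : ℕ, LipschitzOnWith (Real.toNNReal (∑ i : Fin (k + 1), |Λ k i|)) (β k) (Box γ k) := fun k => by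
    refine LipschitzOnWith.of_dist_le_mul fun p hp q hq => ?_
    rw [Real.dist_eq, Real.coe_toNNReal _ (hS0 k)]
    calc |β k p - β k q| ≤ ∑ i : Fin (k + 1), Λ k i * |p i - q i| := hL k p q hp hq
      _ ≤ ∑ i : Fin (k + 1), |Λ k i| * dist p q := Finset.sum_le_sum fun i _ =>
          (mul_le_mul_of_nonneg_right (le_abs_self _) (abs_nonneg _)).trans
            (mul_le_mul_of_nonneg_left (by rw [← Real.dist_eq]; exact dist_le_pi_dist p q i) (abs_nonneg _))
      _ = (∑ i : Fin (k + 1), |Λ k i|) * dist p q := by rw [Finset.sum_mul]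
  choose g hg using fun k => (hLip k).extend_real
  refine ⟨fun k => g k 0, fun k δ hδ => ?_⟩
  set S : ℝ := ∑ i : Fin (k + 1), |Λ k i| with hS
  have hS0k : 0 ≤ S := hS0 k
  refine ⟨min γ (δ / (S + 1)), lt_min hγ (by positivity), fun p hp => ?_⟩
  have hpγ : p ∈ Box γ k := mem_box.mpr fun i => ⟨(hp i).1, (hp i).2.trans (min_le_left _ _)⟩
  have hdist : dist p 0 ≤ δ / (S + 1) := by
    refine (dist_pi_le_iff (by positivity)).mpr fun i => ?_
    rw [Pi.zero_apply, Real.dist_0_eq_abs, abs_of_pos (hp i).1]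
    exact (hp i).2.trans (min_le_right _ _)
  have hEq : β k p = g k p := (hg k).2 hpγ
  have hgL : dist (g k p) (g k 0) ≤ S * dist p 0 := by
    have h := (hg k).1.dist_le_mul p 0
    rwa [Real.coe_toNNReal _ hS0k] at h
  calc |β k p - g k 0| = dist (g k p) (g k 0) := by rw [hEq, Real.dist_eq]
    _ ≤ S * dist p 0 := hgL
    _ ≤ S * (δ / (S + 1)) := mul_le_mul_of_nonneg_left hdist hS0k
    _ ≤ δ := by rw [mul_div_assoc']; exact (div_le_iff₀ (by positivity)).mpr (by nlinarith)

/-- **★★★ LINE 2⁰ — THE κ-FREE CORNER CUT — concluding THE CRUX DECL BY NAME: U3ᴷ → CornerSignᴷ → `EndpointGivenBR13SepCoPH`.**  Per tuple: K3⁷'s moduli give the corner values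
`b` (`exists_scaleAnchor_of_histLipschitz`), CornerSignᴷ their eventual floor `e > 0`, and p599976's sign road `endpointExistence_of_letters_scaleAnchor_eventuallyPos` (N17 ⟹
geometric convergence of `b` to a limit `≥ e` ⟹ constant remainder at that height ⟹ DEF-1's consumer) THE END, at scale `cβ := 1`.  TWO stubs: K3⁷'s letters (shared) and ONE BIT
about def-T's β — the asymptotic-freedom SIGN of its corner values; no colour datum, no pin, no drift VALUE, no `stepBal`, no `def`; BN-F NOT HIT (per-k anchor).  CONDITIONAL on two
hypothesis shapes; K2⁷ NOT closed; nothing of Bałaban asserted. [cite: Balaban1987RG1, Thm 2 p.259 (first sentence), (1.3) p.260, (1.20)-(1.22) p.264 and (2.13) p.268] -/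
theorem EndpointGivenBR13SepCoPH_of_u3K_cornerSignK
    (hU3 : ∀ (F : T4Family) (θ : Node00.Stage13HParams F 2) (hP : θ.Provisos₁₃SepCoPH F 2), (θ.ZhUnity F 2 ∧ θ.SlotsNondegenerate₁₃ F 2) → θ.Admissible F 2 →
      B16.EndStatementBPrinted (Node00.datumOfRecord₁₃SepCoPH F 2 θ hP).C → Window13 F θ hP →
      ∃ (c C ρ : ℝ) (Λ : ℕ → ℕ → ℝ), 0 ≤ c ∧ 0 < ρ ∧ ρ < 1 ∧ ScaleShiftRate c ρ θ.γ (Node00.datumOfRecord₁₃SepCoPH F 2 θ hP).βfun ∧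
        HistLipschitz Λ θ.γ (Node00.datumOfRecord₁₃SepCoPH F 2 θ hP).βfun ∧ T4CouplingMatching.FadingMemory C ρ Λ)
    (hs : ∀ (F : T4Family) (θ : Node00.Stage13HParams F 2) (hP : θ.Provisos₁₃SepCoPH F 2), (θ.ZhUnity F 2 ∧ θ.SlotsNondegenerate₁₃ F 2) → θ.Admissible F 2 →
      B16.EndStatementBPrinted (Node00.datumOfRecord₁₃SepCoPH F 2 θ hP).C → Window13 F θ hP →
      ∀ b : ℕ → ℝ, ScaleAnchor (Node00.datumOfRecord₁₃SepCoPH F 2 θ hP).βfun b → ∃ e : ℝ, 0 < e ∧ ∃ k₀ : ℕ, ∀ k, k₀ ≤ k → e ≤ b k) :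
    Summit.QuantumFields.YangMills.Theses.BalabanUVNodes.EndpointGivenBR13SepCoPH := by
  intro F θ hP hU hθ hB hwin
  obtain ⟨c, -, ρ, Λ, -, hρ0, hρ1, hss, hL, -⟩ := hU3 F θ hP hU hθ hB hwin
  have hγ : 0 < θ.γ := hθ.toStage12.toStage9.gamma_pos
  obtain ⟨b, hb⟩ := exists_scaleAnchor_of_histLipschitz hγ hL
  obtain ⟨e, he, hev⟩ := hs F θ hP hU hθ hB hwin b hb
  have hb1 : ScaleAnchor (Node00.datumOfRecord₁₃SepCoPH F 2 θ hP).βfun (fun k => (1 : ℝ) * b k) := by simpa only [one_mul] using hb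
  exact endpointExistence_of_letters_scaleAnchor_eventuallyPos (Node00.datumOfRecord₁₃SepCoPH F 2 θ hP).fwd hγ hρ0.le hρ1 hss hL one_pos he hb1 hev

/-- **★★ … and in LIMIT FORM (idea-7 ed.1's one private bit, κ-free; p607079's corner-sign conjunct without its ∃κ guard): U3ᴷ → CornerLimPosᴷ → `EndpointGivenBR13SepCoPH`** —
N17 makes every anchoring sequence converge (p599976 `tendsto_of_scaleShiftRate_scaleAnchor`), so «positive LIMIT» gives the eventual floor `binf ∕ 2`.  CONDITIONAL; K2⁷ NOT closed.
[cite: Balaban1987RG1, Thm 2 p.259 (first sentence), (1.3) p.260, (1.20)-(1.22) p.264 and (2.13) p.268] -/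
theorem EndpointGivenBR13SepCoPH_of_u3K_cornerLimPosK
    (hU3 : ∀ (F : T4Family) (θ : Node00.Stage13HParams F 2) (hP : θ.Provisos₁₃SepCoPH F 2), (θ.ZhUnity F 2 ∧ θ.SlotsNondegenerate₁₃ F 2) → θ.Admissible F 2 →
      B16.EndStatementBPrinted (Node00.datumOfRecord₁₃SepCoPH F 2 θ hP).C → Window13 F θ hP →
      ∃ (c C ρ : ℝ) (Λ : ℕ → ℕ → ℝ), 0 ≤ c ∧ 0 < ρ ∧ ρ < 1 ∧ ScaleShiftRate c ρ θ.γ (Node00.datumOfRecord₁₃SepCoPH F 2 θ hP).βfun ∧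
        HistLipschitz Λ θ.γ (Node00.datumOfRecord₁₃SepCoPH F 2 θ hP).βfun ∧ T4CouplingMatching.FadingMemory C ρ Λ)
    (hs : ∀ (F : T4Family) (θ : Node00.Stage13HParams F 2) (hP : θ.Provisos₁₃SepCoPH F 2), (θ.ZhUnity F 2 ∧ θ.SlotsNondegenerate₁₃ F 2) → θ.Admissible F 2 →
      B16.EndStatementBPrinted (Node00.datumOfRecord₁₃SepCoPH F 2 θ hP).C → Window13 F θ hP →
      ∀ b : ℕ → ℝ, ScaleAnchor (Node00.datumOfRecord₁₃SepCoPH F 2 θ hP).βfun b → ∀ binf : ℝ, Tendsto b atTop (𝓝 binf) → 0 < binf) :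
    Summit.QuantumFields.YangMills.Theses.BalabanUVNodes.EndpointGivenBR13SepCoPH := by
  refine EndpointGivenBR13SepCoPH_of_u3K_cornerSignK hU3 fun F θ hP hU hθ hB hwin b hb => ?_
  obtain ⟨c, -, ρ, Λ, -, -, hρ1, hss, -, -⟩ := hU3 F θ hP hU hθ hB hwin
  obtain ⟨binf, hlim, -⟩ := tendsto_of_scaleShiftRate_scaleAnchor hθ.toStage12.toStage9.gamma_pos hρ1 hb hss
  have hpos : 0 < binf := hs F θ hP hU hθ hB hwin b hb binf hlim
  exact ⟨binf / 2, half_pos hpos, Filter.eventually_atTop.mp (hlim.eventually (eventually_ge_nhds (half_lt_self hpos)))⟩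

/-- **∃-FORM TWIN (the κ-free AnchorPositiveᴷ): U3ᴷ → «SOME eventually-positive sequence anchors the β of record» → `EndpointGivenBR13SepCoPH`** — by anchor uniqueness
(`ScaleAnchor.eq`) the witness IS the corner-value sequence, so under U3ᴷ the ∃-form and the ∀-form CornerSignᴷ are interchangeable; AnchorPositiveᴷ is this text with the
witness additionally NAMED `θ.cβ • beta0OfJs F κ`.  CONDITIONAL; K2⁷ NOT closed. [cite: Balaban1987RG1, Thm 2 p.259 (first sentence), (1.3) p.260 and (2.13) p.268] -/
theorem EndpointGivenBR13SepCoPH_of_u3K_someCornerPosK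
    (hU3 : ∀ (F : T4Family) (θ : Node00.Stage13HParams F 2) (hP : θ.Provisos₁₃SepCoPH F 2), (θ.ZhUnity F 2 ∧ θ.SlotsNondegenerate₁₃ F 2) → θ.Admissible F 2 →
      B16.EndStatementBPrinted (Node00.datumOfRecord₁₃SepCoPH F 2 θ hP).C → Window13 F θ hP →
      ∃ (c C ρ : ℝ) (Λ : ℕ → ℕ → ℝ), 0 ≤ c ∧ 0 < ρ ∧ ρ < 1 ∧ ScaleShiftRate c ρ θ.γ (Node00.datumOfRecord₁₃SepCoPH F 2 θ hP).βfun ∧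
        HistLipschitz Λ θ.γ (Node00.datumOfRecord₁₃SepCoPH F 2 θ hP).βfun ∧ T4CouplingMatching.FadingMemory C ρ Λ)
    (hs : ∀ (F : T4Family) (θ : Node00.Stage13HParams F 2) (hP : θ.Provisos₁₃SepCoPH F 2), (θ.ZhUnity F 2 ∧ θ.SlotsNondegenerate₁₃ F 2) → θ.Admissible F 2 →
      B16.EndStatementBPrinted (Node00.datumOfRecord₁₃SepCoPH F 2 θ hP).C → Window13 F θ hP →
      ∃ b : ℕ → ℝ, ScaleAnchor (Node00.datumOfRecord₁₃SepCoPH F 2 θ hP).βfun b ∧ ∃ e : ℝ, 0 < e ∧ ∃ k₀ : ℕ, ∀ k, k₀ ≤ k → e ≤ b k) :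
    Summit.QuantumFields.YangMills.Theses.BalabanUVNodes.EndpointGivenBR13SepCoPH := by
  refine EndpointGivenBR13SepCoPH_of_u3K_cornerSignK hU3 fun F θ hP hU hθ hB hwin b hb => ?_
  obtain ⟨b', hb', he⟩ := hs F θ hP hU hθ hB hwin
  rw [hb.eq hb']
  exact he

/-- **AnchorPositiveᴷ ⟹ CornerSignᴷ** (κ-keyed ⟹ κ-free: a naming κ with positive limit makes EVERY anchoring sequence eventually ≥ `θ.cβ · lim ∕ 2`, by anchor uniqueness
`ScaleAnchor.eq` and the tree's convergence) — LINE 2″ factors through LINE 2⁰. [cite: Balaban1987RG1, (1.3) p.260 and (2.13) p.268] -/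
theorem cornerSignK_of_anchorPositiveK
    (hA : ∀ (F : T4Family) (θ : Node00.Stage13HParams F 2) (hP : θ.Provisos₁₃SepCoPH F 2), (θ.ZhUnity F 2 ∧ θ.SlotsNondegenerate₁₃ F 2) → θ.Admissible F 2 →
      B16.EndStatementBPrinted (Node00.datumOfRecord₁₃SepCoPH F 2 θ hP).C → Window13 F θ hP →
      ∃ κ : StepColourData, 0 < CauchyRate.lim (beta0OfJs F κ) ∧ ScaleAnchor (Node00.datumOfRecord₁₃SepCoPH F 2 θ hP).βfun (fun k => θ.cβ * beta0OfJs F κ k)) :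
    ∀ (F : T4Family) (θ : Node00.Stage13HParams F 2) (hP : θ.Provisos₁₃SepCoPH F 2), (θ.ZhUnity F 2 ∧ θ.SlotsNondegenerate₁₃ F 2) → θ.Admissible F 2 →
      B16.EndStatementBPrinted (Node00.datumOfRecord₁₃SepCoPH F 2 θ hP).C → Window13 F θ hP →
      ∀ b : ℕ → ℝ, ScaleAnchor (Node00.datumOfRecord₁₃SepCoPH F 2 θ hP).βfun b → ∃ e : ℝ, 0 < e ∧ ∃ k₀ : ℕ, ∀ k, k₀ ≤ k → e ≤ b k :=
  fun F θ hP hU hθ hB hwin b hb => by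
  obtain ⟨κ, hpos, hN⟩ := hA F θ hP hU hθ hB hwin
  obtain ⟨k₀, hk₀⟩ := eventuallyFloor_of_lim_pos F κ hpos
  have hcβ : 0 < θ.cβ := hθ.toStage9.chart.1
  refine ⟨θ.cβ * (CauchyRate.lim (beta0OfJs F κ) / 2), mul_pos hcβ (half_pos hpos), k₀, fun k hk => ?_⟩
  rw [hb.eq hN]
  exact mul_le_mul_of_nonneg_left (hk₀ k hk) hcβ.le

/-- **Anchorᴷ + CornerSignᴷ ⟹ AnchorPositiveᴷ** (the naming κ's scaled numbers anchor, so they are eventually ≥ `e`, whence `lim ≥ e ∕ θ.cβ > 0` by §1) — with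
`cornerSignK_of_anchorPositiveK`: AnchorPositiveᴷ ⟺ Anchorᴷ ∧ CornerSignᴷ, i.e. LINE 2″'s private stub = the κ-free sign bit + the bare identification. [cite: Balaban1987RG1, (1.3) p.260 and (2.13) p.268] -/
theorem anchorPositiveK_of_anchorK_cornerSignK
    (hA : ∀ (F : T4Family) (θ : Node00.Stage13HParams F 2) (hP : θ.Provisos₁₃SepCoPH F 2), (θ.ZhUnity F 2 ∧ θ.SlotsNondegenerate₁₃ F 2) → θ.Admissible F 2 →
      B16.EndStatementBPrinted (Node00.datumOfRecord₁₃SepCoPH F 2 θ hP).C → Window13 F θ hP →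
      ∃ κ : StepColourData, ScaleAnchor (Node00.datumOfRecord₁₃SepCoPH F 2 θ hP).βfun (fun k => θ.cβ * beta0OfJs F κ k))
    (hs : ∀ (F : T4Family) (θ : Node00.Stage13HParams F 2) (hP : θ.Provisos₁₃SepCoPH F 2), (θ.ZhUnity F 2 ∧ θ.SlotsNondegenerate₁₃ F 2) → θ.Admissible F 2 →
      B16.EndStatementBPrinted (Node00.datumOfRecord₁₃SepCoPH F 2 θ hP).C → Window13 F θ hP →
      ∀ b : ℕ → ℝ, ScaleAnchor (Node00.datumOfRecord₁₃SepCoPH F 2 θ hP).βfun b → ∃ e : ℝ, 0 < e ∧ ∃ k₀ : ℕ, ∀ k, k₀ ≤ k → e ≤ b k) :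
    ∀ (F : T4Family) (θ : Node00.Stage13HParams F 2) (hP : θ.Provisos₁₃SepCoPH F 2), (θ.ZhUnity F 2 ∧ θ.SlotsNondegenerate₁₃ F 2) → θ.Admissible F 2 →
      B16.EndStatementBPrinted (Node00.datumOfRecord₁₃SepCoPH F 2 θ hP).C → Window13 F θ hP →
      ∃ κ : StepColourData, 0 < CauchyRate.lim (beta0OfJs F κ) ∧ ScaleAnchor (Node00.datumOfRecord₁₃SepCoPH F 2 θ hP).βfun (fun k => θ.cβ * beta0OfJs F κ k) :=
  fun F θ hP hU hθ hB hwin => by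
  obtain ⟨κ, hN⟩ := hA F θ hP hU hθ hB hwin
  obtain ⟨e, he, k₀, hk₀⟩ := hs F θ hP hU hθ hB hwin _ hN
  have hcβ : 0 < θ.cβ := hθ.toStage9.chart.1
  refine ⟨κ, lim_pos_of_eventuallyPos F κ (div_pos he hcβ) ⟨k₀, fun k hk => ?_⟩, hN⟩
  rw [div_le_iff₀ hcβ, mul_comm]
  exact hk₀ k hk

end KappaFree

end Summit.QuantumFields.YangMills.Theorems.BalabanUVNodesK2CornerRoadSign
end
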